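import Summits.FinalStateConjecture.FinalStateConjecture.Theorems.EIHFluxBalanceInertialRecessionVirialIntegral
import Summits.FinalStateConjecture.FinalStateConjecture.Theorems.EIHFluxBalanceInertialRecessionVirialClusterLaw
import Summits.FinalStateConjecture.FinalStateConjecture.Theorems.EIHFluxBalanceInertialRecessionVirialMotion
import Summits.FinalStateConjecture.FinalStateConjecture.Theorems.EIHFluxBalanceInertialRecessionVirialEnvelope
import Summits.FinalStateConjecture.FinalStateConjecture.Theorems.EIHFluxBalanceInertialRecessionStubEndgameOracleTight

/-!
# Route EIHFluxBalance — crux `InertialRecession`, abstract endgame for general `N`: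
# the virial inequality from the window hypotheses of `stub_pairwiseDichotomy`

Helper file for the crux `stmt-FinalStateConjecture-10166` (virial route; `InertialRecession_seat0_session8_note.md` §A).
Mathlib-only. The SHELL around `frozen_block_virial_integral`: from the literal hypotheses of the line stub
`stub_pairwiseDichotomy` (masses, cone, pairwise separation `→ ∞`, `‖vᵢ‖ ≤ k < 1`, slaving `ξ̇ᵢ − vᵢ → 0`, the window law `hWL`
and the identification `hID`, both for ALL test scales `ρ → ∞` and all `δ`) and a root `𝒦` (`|𝒦| ≥ 2`) that is eventually
`1`-gapped, we CHOOSE the constants `δ = 1/10`, `c₀ = (κ − κ²)/2`, `Λ = max 32 (2κ²/((1−2δ)c₀))`, the fine step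
`h = min (1/16, 1/(4(Λ+1)), δ/(1+3δ), δc₀/(2κ²))` (level offset `k₀ = 0`), the test scale
`ρ(t) = δ · min ((F_r t)⁻¹/(2(1+3δ)), c₀ t/2)` with `F_r` an antitone envelope of `1/r_min` (`r_min` the minimal pairwise
distance, `→ ∞`), instantiate `hWL`/`hID` there, and derive

the node law `hNode` (`clusterLaw_constPath'` + `Oracle.norm_momentum_sub_le_of_components`), capped antitone envelopes
`Fζ, FΦ, Fe ≤ 1` (`exists_capped_envelope`), the speed bound and a threshold `T₂`, whence `virial_inequality_on_grid` /
`virial_inequality_of_windows`: an antitone rate `ε → 0`, a junk constant `C_J` and `h > 0` with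
`(2M_𝒦)⁻¹ ∫_T^{T+nh} σ₂ − ∫_T^{T+nh} ε − C_J Dₙ ≤ G(T + nh) − G(T)` for `T ≥ T₂`, `Dₙ ≥ diam 𝒦(T + nh)`,
`G = Σ_{𝒦} ⟨Mⱼγⱼvⱼ, ξⱼ − ξ_c⟩`, `σ₂ = Σ_{j,l∈𝒦} MⱼM_l ‖vⱼ − v_l‖²`.
-/
noncomputable section

open Finset Filter Topology MeasureTheory intervalIntegral

namespace Summit.FinalStateConjecture.FinalStateConjecture.Theorems.SublinearIsFree.Virial

open Literature.Geometry.Lorentzian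

variable {N : ℕ}

/-- **Capped antitone envelope.** A function tending to `0` at `+∞` lies, on `[T, ∞) ∩ [t/2, ∞)` for every `T ≥ T₀`, below
`F t` for an antitone `F → 0` with `0 ≤ F ≤ 1`. [folklore] -/
theorem exists_capped_envelope {f : ℝ → ℝ} (hf : Tendsto f atTop (𝓝 0)) :
    ∃ F : ℝ → ℝ, Antitone F ∧ Tendsto F atTop (𝓝 0) ∧ (∀ t, 0 ≤ F t) ∧ (∀ t, F t ≤ 1) ∧
      ∃ T₀ : ℝ, 0 ≤ T₀ ∧ ∀ T, T₀ ≤ T → ∀ s t : ℝ, T ≤ s → t / 2 ≤ s → f s ≤ F t := by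
  obtain ⟨F, hFa, hF0, hFnn, T₀, hdom⟩ := exists_antitone_envelope hf
  obtain ⟨T₁, hT₁⟩ := (hF0.eventually (eventually_le_nhds (by norm_num : (0 : ℝ) < 1))).exists_forall_of_atTop
  obtain ⟨Ts, hTs⟩ : ∃ Ts : ℝ, Ts = max (max T₀ T₁) 0 := ⟨_, rfl⟩
  have hTs0 : T₀ ≤ Ts := hTs ▸ (le_max_left _ _).trans (le_max_left _ _)
  have hTs1 : T₁ ≤ Ts := hTs ▸ (le_max_right _ _).trans (le_max_left _ _)
  have hTs2 : 0 ≤ Ts := hTs ▸ le_max_right _ _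
  refine ⟨fun t ↦ F (max t Ts), fun a b hab ↦ hFa (max_le_max hab le_rfl), ?_, fun t ↦ hFnn _,
    fun t ↦ (hFa (le_max_right t Ts)).trans (hT₁ Ts hTs1), Ts, hTs2, ?_⟩
  · refine hF0.congr' ?_
    filter_upwards [eventually_ge_atTop Ts] with t ht
    simp [max_eq_left ht]
  · intro T hT s t hTs' hts
    show f s ≤ F (max t Ts)
    rcases le_total t Ts with h | h
    · rw [max_eq_right h]
      exact hdom Ts hTs0 s (by linarith)
    · rw [max_eq_left h]
      exact hdom t (hTs0.trans h) s hts

/-- **The frozen-block virial inequality, integral form, level offset `k₀ = 0`, threshold hypotheses.**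
`frozen_block_virial_integral` with the grid hypotheses replaced by their `∀ t ≥ T` forms, the rate named `ε` and the
junk constant named `C_J`. [folklore] -/
theorem frozen_block_virial_integral₀ (ξ v : Fin N → ℝ → E3) (M : Fin N → ℝ) (𝒦 : Finset (Fin N))
    {κ δ C c₀ Λ h T TL k : ℝ} {n : ℕ} (ζ rmin Fζ FΦ Fe : ℝ → ℝ)
    (hNode : ∀ (t R : ℝ) (c : E3) (A : Finset (Fin N)), TL ≤ t → 0 < R → R ≤ c₀ * t →
      min (rmin t / (2 * (1 + 3 * δ))) (c₀ * t) ≤ R → ‖c‖ ≤ κ ^ 2 * t →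
      (∀ j ∈ A, ‖ξ j t - c‖ ≤ (1 - 2 * δ) * R) → (∀ j ∉ A, (1 + 2 * δ) * R ≤ ‖ξ j t - c‖) →
      ∀ s' ∈ Set.Icc t (t + δ * R),
        ‖∑ j ∈ A, (M j * (√(1 - ‖v j s'‖ ^ 2))⁻¹) • v j s' - ∑ j ∈ A, (M j * (√(1 - ‖v j t‖ ^ 2))⁻¹) • v j t‖ ≤
          3 * (C * ((s' - t) * (R ^ (3 / 2 : ℝ))⁻¹) + ζ t + ζ s'))
    (hC : 0 ≤ C) (hδ : 0 < δ) (hδ1 : δ ≤ 1 / 10) (hΛ : 32 ≤ Λ) (hΛκ : 2 * κ ^ 2 ≤ Λ * ((1 - 2 * δ) * c₀)) (hc₀ : 0 < c₀)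
    (hc₀1 : c₀ ≤ 1) (hh : 0 < h) (hT : 1 ≤ T) (hTL : TL ≤ T)
    (hδ₁a : h ≤ δ / (1 + 3 * δ)) (hδ₁b : h * (2 * κ ^ 2) ≤ δ * c₀) (hδ₁c : h ≤ 1 / 16) (hδ₁d : h * (Λ + 1) ≤ 1 / 4)
    (hcone : ∀ t : ℝ, T ≤ t → ∀ x : Fin N, ‖ξ x t‖ ≤ κ ^ 2 * t)
    (hrmin : ∀ (t : ℝ) (x y : Fin N), x ≠ y → rmin t ≤ ‖ξ x t - ξ y t‖)
    (hrmin2 : ∀ t : ℝ, T ≤ t → 2 ≤ rmin t)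
    (hmove : ∀ (x : Fin N) (s s' : ℝ), T ≤ s → s ≤ s' → ‖ξ x s' - ξ x s‖ ≤ s' - s)
    (hroot : ∀ m : ℕ, m ≤ n → ∃ D G : ℝ, (∀ x ∈ 𝒦, ∀ y ∈ 𝒦, ‖ξ x (T + m * h) - ξ y (T + m * h)‖ ≤ D) ∧
      (∀ x ∈ 𝒦, ∀ z ∈ univ \ 𝒦, G ≤ ‖ξ x (T + m * h) - ξ z (T + m * h)‖) ∧ 1 * D < G)
    (hFζ : ∀ s t : ℝ, T ≤ s → t / 2 ≤ s → ζ s ≤ Fζ t)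
    (hFΦ : ∀ s t : ℝ, T ≤ s → t / 2 ≤ s →
      (((1 + 3 * δ)⁻¹) ^ (3 / 2 : ℝ))⁻¹ * √2 * (√(rmin s))⁻¹ + 2 * κ ^ 2 * (c₀ ^ (3 / 2 : ℝ))⁻¹ * (√s)⁻¹ ≤ FΦ t)
    (hFe : ∀ s t : ℝ, T ≤ s → t / 2 ≤ s → ∀ j, ‖deriv (ξ j) s - v j s‖ ≤ Fe t) (hFe1 : ∀ t, Fe t ≤ 1)
    (hFζ0 : ∀ t, 0 ≤ Fζ t) (hFζ1 : ∀ t, Fζ t ≤ 1) (hFΦ0 : ∀ t, 0 ≤ FΦ t) (hFΦ1 : ∀ t, FΦ t ≤ 1)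
    (hFζa : Antitone Fζ) (hFΦa : Antitone FΦ) (hFea : Antitone Fe)
    (hM : ∀ i, 0 < M i) (hk : k < 1) (hvk : ∀ i t, ‖v i t‖ ≤ k) (hvc : ∀ i, Continuous (v i))
    (hξ : ∀ i, ContDiff ℝ ((⊤ : ℕ∞) : WithTop ℕ∞) (ξ i)) (h𝒦 : 2 ≤ 𝒦.card)
    (ε : ℝ → ℝ) (hε : ∀ t, ε t = (2 * (√(1 - k ^ 2))⁻¹ * (∑ i ∈ 𝒦, M i) * Fe t +
      4 * 𝒦.card * (3 * (C * h * FΦ t + 2 * Fζ t))) +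
      2 ^ 𝒦.card * (3 * (96 * (4 * Λ + 2) ^ N + 2 * h) * (C * FΦ t + 2 * Fζ t / h)))
    (CJ : ℝ) (hCJ : CJ = 2 ^ 𝒦.card * (3 * (96 * (4 * Λ + 2) ^ N + 2 * h) * (C * h + 2) * 2))
    {Dn : ℝ} (hDn0 : 0 ≤ Dn) (hDn : ∀ x ∈ 𝒦, ∀ y ∈ 𝒦, ‖ξ x (T + n * h) - ξ y (T + n * h)‖ ≤ Dn) :
    (2 * ∑ i ∈ 𝒦, M i)⁻¹ * (∫ s in T..(T + n * h), ∑ j ∈ 𝒦, ∑ l ∈ 𝒦, M j * M l * ‖v j s - v l s‖ ^ 2) -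
        (∫ t in T..(T + n * h), ε t) - CJ * Dn ≤
      (∑ j ∈ 𝒦, inner ℝ ((M j * (√(1 - ‖v j (T + n * h)‖ ^ 2))⁻¹) • v j (T + n * h))
        (ξ j (T + n * h) - (∑ l ∈ 𝒦, M l)⁻¹ • ∑ l ∈ 𝒦, M l • ξ l (T + n * h))) -
      (∑ j ∈ 𝒦, inner ℝ ((M j * (√(1 - ‖v j T‖ ^ 2))⁻¹) • v j T)
        (ξ j T - (∑ l ∈ 𝒦, M l)⁻¹ • ∑ l ∈ 𝒦, M l • ξ l T)) := by
  have hgrid : ∀ m : ℕ, T ≤ T + m * h := fun m ↦ le_add_of_nonneg_right (by positivity)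
  have hT0 : 0 < T := by linarith
  have hhT : h ≤ T := by linarith
  have hδ₁a' : h / 2 ^ (0 : ℕ) ≤ δ / (1 + 3 * δ) := by rwa [pow_zero, div_one]
  have hδ₁b' : h / 2 ^ (0 : ℕ) * (2 * κ ^ 2) ≤ δ * c₀ := by rwa [pow_zero, div_one]
  have hδ₁c' : h / 2 ^ (0 : ℕ) ≤ 1 / 16 := by rwa [pow_zero, div_one]
  have hδ₁d' : h / 2 ^ (0 : ℕ) * (Λ + 1) ≤ 1 / 4 := by rwa [pow_zero, div_one]
  have hk₀r : ∀ m : ℕ, (2 : ℝ) ^ (0 + 1) ≤ rmin (T + m * h) := fun m ↦ by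
    rw [zero_add, pow_one]; exact hrmin2 _ (hgrid m)
  have hmoveG : ∀ (x : Fin N) (m m' : ℕ), m ≤ m' → ‖ξ x (T + m' * h) - ξ x (T + m * h)‖ ≤ (m' - m) * h := by
    intro x m m' hmm'
    have hc : (m : ℝ) ≤ m' := by exact_mod_cast hmm'
    have hle : T + m * h ≤ T + m' * h := by nlinarith
    have := hmove x _ _ (hgrid m) hle
    calc ‖ξ x (T + m' * h) - ξ x (T + m * h)‖ ≤ T + m' * h - (T + m * h) := this
      _ = (m' - m) * h := by ring
  have hmain := frozen_block_virial_integral ξ v M 𝒦 (k₀ := 0) ζ rmin Fζ FΦ Fe hNode hC hδ hδ1 hΛ hΛκ hc₀ hc₀1 hh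
    hT0 hTL hhT hδ₁a' hδ₁b' hδ₁c' hδ₁d' (fun m x ↦ hcone _ (hgrid m) x) (fun m x y hxy ↦ hrmin _ x y hxy)
    (fun m ↦ zero_lt_two.trans_le (hrmin2 _ (hgrid m))) hk₀r hmoveG hroot hFζ
    (fun m t ht ↦ hFΦ _ t (hgrid m) ht) hFe hFe1 hFζ0 hFζ1 hFΦ0 hFΦ1 hFζa hFΦa hM hk hvk hvc hξ h𝒦 hDn0 hDn hFea
  have e1 : (2 : ℝ) ^ 𝒦.card * (3 * (96 * (4 * Λ + 2) ^ N + 2 * (h / 2 ^ (0 : ℕ))) * (C * (h / 2 ^ (0 : ℕ)) + 2) *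
      (2 * Dn)) = CJ * Dn := by
    rw [hCJ, pow_zero, div_one]; ring
  have e2 : (∫ t in T..(T + n * h), ((2 * (√(1 - k ^ 2))⁻¹ * (∑ i ∈ 𝒦, M i) * Fe t +
          4 * 𝒦.card * (3 * (C * (h / 2 ^ (0 : ℕ)) * FΦ t + 2 * Fζ t))) +
        2 ^ 𝒦.card * (3 * (96 * (4 * Λ + 2) ^ N + 2 * (h / 2 ^ (0 : ℕ))) *
          (C * FΦ t + 2 * Fζ t / (h / 2 ^ (0 : ℕ)))))) = ∫ t in T..(T + n * h), ε t := by
    simp only [pow_zero, div_one, hε]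
  rw [e1, e2] at hmain
  exact hmain

set_option maxHeartbeats 400000 in
/-- **The virial inequality from the window hypotheses, grid form**: as `virial_inequality_of_windows` (see the module
docstring) but the root need only be `1`-gapped at the grid times `T + mh`, `m ≤ n`, of the interval at hand. [folklore] -/
theorem virial_inequality_on_grid (M : Fin N → ℝ) (ξ v : Fin N → ℝ → E3) (κ : ℝ) (P : ℝ → E3 → ℝ → Fin 4 → ℝ)
    (hM : ∀ i, 0 < M i) (hκ0 : 0 < κ) (hκ1 : κ < 1) (hξ : ∀ i, ContDiff ℝ ((⊤ : ℕ∞) : WithTop ℕ∞) (ξ i))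
    (hcone : ∀ i, ∀ᶠ t in atTop, ‖ξ i t‖ ≤ κ ^ 2 * t)
    (hsep : ∀ i j, i ≠ j → Tendsto (fun t ↦ ‖ξ i t - ξ j t‖) atTop atTop) (hvc : ∀ i, Continuous (v i))
    (hk : ∃ k : ℝ, 0 ≤ k ∧ k < 1 ∧ ∀ i t, ‖v i t‖ ≤ k)
    (hslave : ∀ i, Tendsto (fun t ↦ deriv (ξ i) t - v i t) atTop (𝓝 0))
    (hWL : ∀ ρ : ℝ → ℝ, Tendsto ρ atTop atTop → ∀ δ : ℝ, 0 < δ → δ < 1 → ∃ (C T : ℝ),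
      ∀ (t₁ t₂ : ℝ) (c : ℝ → E3) (R : ℝ → ℝ), T ≤ t₁ → t₁ ≤ t₂ →
      (∀ s ∈ Set.Icc t₁ t₂, ∀ s' ∈ Set.Icc t₁ t₂, ‖c s - c s'‖ ≤ 2 * |s - s'| ∧ |R s - R s'| ≤ 2 * |s - s'|) →
      (∀ s ∈ Set.Icc t₁ t₂, ρ s ≤ δ * R s ∧ ‖c s‖ + R s ≤ (κ + κ ^ 2) / 2 * s ∧
        ∀ j, ‖ξ j s - c s‖ ≤ (1 - δ) * R s ∨ (1 + δ) * R s ≤ ‖ξ j s - c s‖) →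
      ∀ μ : Fin 4, |P t₂ (c t₂) (R t₂) μ - P t₁ (c t₁) (R t₁) μ| ≤ C * ∫ s in t₁..t₂, (R s ^ (3 / 2 : ℝ))⁻¹)
    (hID : ∀ ρ : ℝ → ℝ, Tendsto ρ atTop atTop → ∀ δ : ℝ, 0 < δ → δ < 1 → ∃ (T : ℝ) (ζ : ℝ → ℝ),
      Tendsto ζ atTop (𝓝 0) ∧ ∀ (t : ℝ) (c : E3) (R : ℝ) (A : Finset (Fin N)), T ≤ t → ρ t ≤ δ * R →
      ‖c‖ + R ≤ (κ + κ ^ 2) / 2 * t → (∀ j, ‖ξ j t - c‖ ≤ (1 - δ) * R ∨ (1 + δ) * R ≤ ‖ξ j t - c‖) →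
      (∀ j, j ∈ A ↔ ‖ξ j t - c‖ ≤ (1 - δ) * R) →
      |P t c R 0 - ∑ j ∈ A, M j * (√(1 - ‖v j t‖ ^ 2))⁻¹| ≤ ζ t ∧
      ∀ k : Fin 3, |P t c R k.succ - ∑ j ∈ A, M j * (√(1 - ‖v j t‖ ^ 2))⁻¹ * v j t k| ≤ ζ t)
    (𝒦 : Finset (Fin N)) (h𝒦 : 2 ≤ 𝒦.card) :
    ∃ (h CJ T₂ : ℝ) (ε : ℝ → ℝ), 0 < h ∧ 0 ≤ CJ ∧ Antitone ε ∧ Tendsto ε atTop (𝓝 0) ∧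
      ∀ T : ℝ, T₂ ≤ T → ∀ n : ℕ,
        (∀ m : ℕ, m ≤ n → ∃ D G : ℝ, (∀ x ∈ 𝒦, ∀ y ∈ 𝒦, ‖ξ x (T + m * h) - ξ y (T + m * h)‖ ≤ D) ∧
          (∀ x ∈ 𝒦, ∀ z ∈ univ \ 𝒦, G ≤ ‖ξ x (T + m * h) - ξ z (T + m * h)‖) ∧ 1 * D < G) →
        ∀ Dn : ℝ, 0 ≤ Dn →
        (∀ x ∈ 𝒦, ∀ y ∈ 𝒦, ‖ξ x (T + n * h) - ξ y (T + n * h)‖ ≤ Dn) →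
        (2 * ∑ i ∈ 𝒦, M i)⁻¹ * (∫ s in T..(T + n * h), ∑ j ∈ 𝒦, ∑ l ∈ 𝒦, M j * M l * ‖v j s - v l s‖ ^ 2) -
            (∫ t in T..(T + n * h), ε t) - CJ * Dn ≤
          (∑ j ∈ 𝒦, inner ℝ ((M j * (√(1 - ‖v j (T + n * h)‖ ^ 2))⁻¹) • v j (T + n * h))
              (ξ j (T + n * h) - (∑ l ∈ 𝒦, M l)⁻¹ • ∑ l ∈ 𝒦, M l • ξ l (T + n * h))) -
          (∑ j ∈ 𝒦, inner ℝ ((M j * (√(1 - ‖v j T‖ ^ 2))⁻¹) • v j T)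
              (ξ j T - (∑ l ∈ 𝒦, M l)⁻¹ • ∑ l ∈ 𝒦, M l • ξ l T)) := by
  classical
  -- speed bound, the speed cap `k`, masses
  obtain ⟨T_M, hTM⟩ := exists_forall_norm_sub_le_sub_of_slaved' (fun i ↦ (hξ i).differentiable (by simp)) hk hslave
  obtain ⟨k, hk0, hk1, hvk⟩ := hk
  have hMK : 0 ≤ ∑ i ∈ 𝒦, M i := Finset.sum_nonneg fun i _ ↦ (hM i).le
  -- the constants
  obtain ⟨δ, hδdef⟩ : ∃ δ : ℝ, δ = 1 / 10 := ⟨_, rfl⟩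
  have hδ : 0 < δ := by rw [hδdef]; norm_num
  have hδ1 : δ ≤ 1 / 10 := hδdef.le
  have hδlt : δ < 1 := by rw [hδdef]; norm_num
  obtain ⟨c₀, hc₀def⟩ : ∃ c₀ : ℝ, c₀ = (κ - κ ^ 2) / 2 := ⟨_, rfl⟩
  have hc₀ : 0 < c₀ := by
    have : κ ^ 2 < κ := by nlinarith
    rw [hc₀def]; linarith
  have hc₀1 : c₀ ≤ 1 := by rw [hc₀def]; nlinarith
  have h12δ : 0 < (1 - 2 * δ) * c₀ := by
    have : 0 < 1 - 2 * δ := by rw [hδdef]; norm_num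
    positivity
  obtain ⟨Λ, hΛdef⟩ : ∃ Λ : ℝ, Λ = max 32 (2 * κ ^ 2 / ((1 - 2 * δ) * c₀)) := ⟨_, rfl⟩
  have hΛ : 32 ≤ Λ := hΛdef ▸ le_max_left _ _
  have hΛκ : 2 * κ ^ 2 ≤ Λ * ((1 - 2 * δ) * c₀) := (div_le_iff₀ h12δ).mp (hΛdef ▸ le_max_right _ _)
  have hΛ1 : 0 < 4 * (Λ + 1) := by linarith
  have hκ2 : 0 < 2 * κ ^ 2 := by positivity
  obtain ⟨h, hhdef⟩ : ∃ h, h = min (min (1 / 16) (1 / (4 * (Λ + 1)))) (min (δ / (1 + 3 * δ)) (δ * c₀ / (2 * κ ^ 2))) := ⟨_, rfl⟩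
  have hh : 0 < h := by
    rw [hhdef]
    exact lt_min (lt_min (by norm_num) (by positivity)) (lt_min (by positivity) (by positivity))
  have hδ₁a : h ≤ δ / (1 + 3 * δ) := hhdef ▸ (min_le_right _ _).trans (min_le_left _ _)
  have hδ₁b : h * (2 * κ ^ 2) ≤ δ * c₀ :=
    (le_div_iff₀ hκ2).mp (hhdef ▸ (min_le_right _ _).trans (min_le_right _ _))
  have hδ₁c : h ≤ 1 / 16 := hhdef ▸ (min_le_left _ _).trans (min_le_left _ _)
  have hδ₁d : h * (Λ + 1) ≤ 1 / 4 := by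
    have := (le_div_iff₀ hΛ1).mp (hhdef ▸ (min_le_left _ _).trans (min_le_right _ _))
    linarith
  -- the minimal pairwise distance `r_min → ∞`
  obtain ⟨x₀, hx₀, y₀, hy₀, hxy₀⟩ := Finset.one_lt_card.mp (by omega : 1 < 𝒦.card)
  have hne : ((univ : Finset (Fin N)).offDiag).Nonempty := ⟨(x₀, y₀), by simp [hxy₀]⟩
  obtain ⟨rminF, hrdef⟩ : ∃ r : ℝ → ℝ, ∀ t, r t = (univ : Finset (Fin N)).offDiag.inf' hne
      (fun p ↦ ‖ξ p.1 t - ξ p.2 t‖) := ⟨_, fun t ↦ rfl⟩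
  have hrle : ∀ (t : ℝ) (x y : Fin N), x ≠ y → rminF t ≤ ‖ξ x t - ξ y t‖ := by
    intro t x y hxy
    rw [hrdef]
    exact Finset.inf'_le (fun p : Fin N × Fin N ↦ ‖ξ p.1 t - ξ p.2 t‖) (by simp [hxy] : (x, y) ∈ (univ : Finset (Fin N)).offDiag)
  have hrT : Tendsto rminF atTop atTop := by
    refine tendsto_atTop.mpr fun A ↦ ?_
    have hall : ∀ᶠ t in atTop, ∀ p ∈ (univ : Finset (Fin N)).offDiag, A ≤ ‖ξ p.1 t - ξ p.2 t‖ :=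
      (Filter.eventually_all_finset _).mpr fun p hp ↦ (hsep p.1 p.2 (Finset.mem_offDiag.mp hp).2.2).eventually_ge_atTop A
    filter_upwards [hall] with t ht
    rw [hrdef]
    exact (Finset.le_inf'_iff hne _).mpr ht
  obtain ⟨T_r, hTr⟩ := (hrT.eventually_ge_atTop 2).exists_forall_of_atTop
  -- a capped envelope of `1 / r_min` and the test scale `ρ → ∞`
  have hrinv : Tendsto (fun t ↦ (rminF t)⁻¹) atTop (𝓝 0) := hrT.inv_tendsto_atTop
  obtain ⟨Fr, hFra, hFr0, hFrnn, -, T_e, hTe0, hFrdom⟩ := exists_capped_envelope hrinv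
  obtain ⟨ρ, hρdef⟩ : ∃ ρ : ℝ → ℝ, ∀ t, ρ t = δ * min ((Fr t)⁻¹ / (2 * (1 + 3 * δ))) (c₀ * t / 2) := ⟨_, fun t ↦ rfl⟩
  have hρT : Tendsto ρ atTop atTop := by
    have hFrinv : Tendsto (fun t ↦ (Fr t)⁻¹) atTop atTop := by
      refine Tendsto.inv_tendsto_nhdsGT_zero (f := Fr) (tendsto_nhdsWithin_iff.mpr ⟨hFr0, ?_⟩)
      filter_upwards [eventually_ge_atTop (max T_e T_r)] with t ht
      have htr : T_r ≤ t := (le_max_right _ _).trans ht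
      have hte : T_e ≤ t := (le_max_left _ _).trans ht
      have h2 : 0 < rminF t := by linarith [hTr t htr]
      have h3 := hFrdom T_e le_rfl t t hte (by linarith [hTe0.trans hte])
      exact Set.mem_Ioi.mpr (lt_of_lt_of_le (inv_pos.mpr h2) h3)
    have h1 : Tendsto (fun t ↦ (Fr t)⁻¹ / (2 * (1 + 3 * δ))) atTop atTop :=
      Tendsto.atTop_div_const (by positivity) hFrinv
    have h2 : Tendsto (fun t : ℝ ↦ c₀ * t / 2) atTop atTop :=
      Tendsto.atTop_div_const (by norm_num) (tendsto_id.const_mul_atTop hc₀)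
    rw [show ρ = fun t ↦ δ * min ((Fr t)⁻¹ / (2 * (1 + 3 * δ))) (c₀ * t / 2) from funext hρdef]
    refine Tendsto.const_mul_atTop hδ (tendsto_atTop.mpr fun A ↦ ?_)
    filter_upwards [tendsto_atTop.mp h1 A, tendsto_atTop.mp h2 A] with t ha hb
    exact le_min ha hb
  have hρ0 : ∀ t, 0 ≤ t → 0 ≤ ρ t := fun t ht ↦ by
    rw [hρdef]
    exact mul_nonneg hδ.le (le_min (div_nonneg (inv_nonneg.mpr (hFrnn t)) (by positivity)) (by positivity))
  -- the window law and the identification at `(ρ, δ)`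
  obtain ⟨C, T_W, hWL'⟩ := hWL ρ hρT δ hδ hδlt
  obtain ⟨T_I, ζ, hζ0, hID'⟩ := hID ρ hρT δ hδ hδlt
  obtain ⟨C', hC'def⟩ : ∃ C' : ℝ, C' = max C 0 := ⟨_, rfl⟩
  have hC' : 0 ≤ C' := hC'def ▸ le_max_right _ _
  have hCC' : C ≤ C' := hC'def ▸ le_max_left _ _
  obtain ⟨T_L, hTLdef⟩ : ∃ T_L : ℝ, T_L = max (max (max T_W T_I) (max T_M T_e)) (max T_r 1) := ⟨_, rfl⟩
  have hLW : T_W ≤ T_L := by rw [hTLdef]; simp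
  have hLI : T_I ≤ T_L := by rw [hTLdef]; simp
  have hLM : T_M ≤ T_L := by rw [hTLdef]; simp
  have hLe : T_e ≤ T_L := by rw [hTLdef]; simp
  have hLr : T_r ≤ T_L := by rw [hTLdef]; simp
  have hL1 : 1 ≤ T_L := by rw [hTLdef]; simp
  have hWL'' : ∀ (t₁ t₂ : ℝ) (c : ℝ → E3) (R : ℝ → ℝ), T_L ≤ t₁ → t₁ ≤ t₂ →
      (∀ s ∈ Set.Icc t₁ t₂, ∀ s' ∈ Set.Icc t₁ t₂, ‖c s - c s'‖ ≤ 2 * |s - s'| ∧ |R s - R s'| ≤ 2 * |s - s'|) →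
      (∀ s ∈ Set.Icc t₁ t₂, ρ s ≤ δ * R s ∧ ‖c s‖ + R s ≤ (κ + κ ^ 2) / 2 * s ∧
        ∀ j, ‖ξ j s - c s‖ ≤ (1 - δ) * R s ∨ (1 + δ) * R s ≤ ‖ξ j s - c s‖) →
      ∀ μ : Fin 4, |P t₂ (c t₂) (R t₂) μ - P t₁ (c t₁) (R t₁) μ| ≤ C' * ∫ s in t₁..t₂, (R s ^ (3 / 2 : ℝ))⁻¹ := by
    intro t₁ t₂ c R ht₁ ht₁₂ hlip hadm μ
    have hI : 0 ≤ ∫ s in t₁..t₂, (R s ^ (3 / 2 : ℝ))⁻¹ := by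
      refine intervalIntegral.integral_nonneg ht₁₂ fun s hs ↦ inv_nonneg.mpr (Real.rpow_nonneg ?_ _)
      have h1 := (hadm s hs).1
      have h2 : 0 ≤ ρ s := hρ0 s (by linarith [hs.1])
      nlinarith
    exact (hWL' t₁ t₂ c R (hLW.trans ht₁) ht₁₂ hlip hadm μ).trans (mul_le_mul_of_nonneg_right hCC' hI)
  have hID'' : ∀ (t : ℝ) (c : E3) (R : ℝ) (A : Finset (Fin N)), T_L ≤ t → ρ t ≤ δ * R →
      ‖c‖ + R ≤ (κ + κ ^ 2) / 2 * t →
      (∀ j, ‖ξ j t - c‖ ≤ (1 - δ) * R ∨ (1 + δ) * R ≤ ‖ξ j t - c‖) → (∀ j, j ∈ A ↔ ‖ξ j t - c‖ ≤ (1 - δ) * R) →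
      |P t c R 0 - ∑ j ∈ A, M j * (√(1 - ‖v j t‖ ^ 2))⁻¹| ≤ ζ t ∧
      ∀ k : Fin 3, |P t c R k.succ - ∑ j ∈ A, M j * (√(1 - ‖v j t‖ ^ 2))⁻¹ * v j t k| ≤ ζ t :=
    fun t c R A ht ↦ hID' t c R A (hLI.trans ht)
  have hmove'' : ∀ j (s s' : ℝ), T_L ≤ s → s ≤ s' → ‖ξ j s' - ξ j s‖ ≤ s' - s :=
    fun j s s' hs hss' ↦ hTM j s s' (hLM.trans hs) hss'
  -- the digested node law
  have hNode : ∀ (t R : ℝ) (c : E3) (A : Finset (Fin N)), T_L ≤ t → 0 < R → R ≤ c₀ * t →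
      min (rminF t / (2 * (1 + 3 * δ))) (c₀ * t) ≤ R → ‖c‖ ≤ κ ^ 2 * t →
      (∀ j ∈ A, ‖ξ j t - c‖ ≤ (1 - 2 * δ) * R) → (∀ j ∉ A, (1 + 2 * δ) * R ≤ ‖ξ j t - c‖) →
      ∀ s' ∈ Set.Icc t (t + δ * R),
        ‖∑ j ∈ A, (M j * (√(1 - ‖v j s'‖ ^ 2))⁻¹) • v j s' - ∑ j ∈ A, (M j * (√(1 - ‖v j t‖ ^ 2))⁻¹) • v j t‖ ≤
          3 * (C' * ((s' - t) * (R ^ (3 / 2 : ℝ))⁻¹) + ζ t + ζ s') := by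
    intro t R c A ht hR hRc hminR hc hin hout s' hs'
    have ht1 : 1 ≤ t := hL1.trans ht
    have hρ' : ∀ s ∈ Set.Icc t (t + δ * R), ρ s ≤ δ * R := by
      intro s hs
      have hs2 : s ≤ 2 * t := by
        have h1 : δ * R ≤ δ * (c₀ * t) := mul_le_mul_of_nonneg_left hRc hδ.le
        have h2 : δ * (c₀ * t) ≤ 1 * (1 * t) := by
          have := mul_le_mul_of_nonneg_right hc₀1 (by linarith : (0 : ℝ) ≤ t)
          have := mul_le_mul hδlt.le this (by positivity) (by norm_num)
          linarith
        linarith [hs.2]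
      have hrpos : 0 < rminF t := by linarith [hTr t (hLr.trans ht)]
      have h1 : (Fr s)⁻¹ ≤ rminF t := inv_le_of_inv_le₀ hrpos (hFrdom T_L hLe t s ht (by linarith))
      rw [hρdef]
      refine mul_le_mul_of_nonneg_left (le_trans (min_le_min ?_ ?_) hminR) hδ.le
      · exact div_le_div_of_nonneg_right h1 (by positivity)
      · nlinarith [hc₀]
    have hcone' : ‖c‖ + R ≤ (κ + κ ^ 2) / 2 * t := by rw [hc₀def] at hRc; linarith
    have hcl := clusterLaw_constPath' M ξ v κ P hδ hκ0.le hWL'' hID'' hmove'' ht hR hρ' hcone' hin hout hs'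
    exact Oracle.norm_momentum_sub_le_of_components A M (fun j ↦ v j t) (fun j ↦ v j s') hcl.2
  -- cone threshold
  obtain ⟨T_c, hTc⟩ := (Filter.eventually_all.mpr hcone).exists_forall_of_atTop
  -- the envelopes
  obtain ⟨Fζ, hFζa, hFζ0, hFζnn, hFζ1, Tz, hTz0, hFζdom⟩ := exists_capped_envelope hζ0
  have he0 : Tendsto (fun u ↦ ∑ i, ‖deriv (ξ i) u - v i u‖) atTop (𝓝 0) := by
    simpa using tendsto_finsetSum (univ : Finset (Fin N)) fun i _ ↦ (hslave i).norm
  obtain ⟨Fe, hFea, hFe0, hFenn, hFe1, Tv, hTv0, hFedom⟩ := exists_capped_envelope he0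
  have hΦ0 : Tendsto (fun u ↦ (((1 + 3 * δ)⁻¹) ^ (3 / 2 : ℝ))⁻¹ * √2 * (√(rminF u))⁻¹ +
      2 * κ ^ 2 * (c₀ ^ (3 / 2 : ℝ))⁻¹ * (√u)⁻¹) atTop (𝓝 0) := by
    have h1 : Tendsto (fun u ↦ (√(rminF u))⁻¹) atTop (𝓝 0) :=
      tendsto_inv_atTop_zero.comp (Real.tendsto_sqrt_atTop.comp hrT)
    have h2 : Tendsto (fun u : ℝ ↦ (√u)⁻¹) atTop (𝓝 0) := tendsto_inv_atTop_zero.comp Real.tendsto_sqrt_atTop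
    simpa using (h1.const_mul ((((1 + 3 * δ)⁻¹) ^ (3 / 2 : ℝ))⁻¹ * √2)).add
      (h2.const_mul (2 * κ ^ 2 * (c₀ ^ (3 / 2 : ℝ))⁻¹))
  obtain ⟨FΦ, hFΦa, hFΦ0, hFΦnn, hFΦ1, TΦ, hTΦ0, hFΦdom⟩ := exists_capped_envelope hΦ0
  -- the rate and the junk constant
  obtain ⟨ε, hεdef⟩ : ∃ ε : ℝ → ℝ, ∀ t, ε t = (2 * (√(1 - k ^ 2))⁻¹ * (∑ i ∈ 𝒦, M i) * Fe t +
      4 * 𝒦.card * (3 * (C' * h * FΦ t + 2 * Fζ t))) +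
      2 ^ 𝒦.card * (3 * (96 * (4 * Λ + 2) ^ N + 2 * h) * (C' * FΦ t + 2 * Fζ t / h)) := ⟨_, fun t ↦ rfl⟩
  have hεa : Antitone ε := by
    have hra := rate_antitone 𝒦 M (N := N) (C := C') (Λ := Λ) (k := k) (d := h) hC' hΛ hh hMK hFζa hFΦa hFea
    intro a b hab
    rw [hεdef, hεdef]
    exact hra hab
  have hεt : Tendsto ε atTop (𝓝 0) := by
    rw [show ε = fun t ↦ (2 * (√(1 - k ^ 2))⁻¹ * (∑ i ∈ 𝒦, M i) * Fe t +
      4 * 𝒦.card * (3 * (C' * h * FΦ t + 2 * Fζ t))) +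
      2 ^ 𝒦.card * (3 * (96 * (4 * Λ + 2) ^ N + 2 * h) * (C' * FΦ t + 2 * Fζ t / h)) from funext hεdef]
    have hlim := ((hFe0.const_mul (2 * (√(1 - k ^ 2))⁻¹ * ∑ i ∈ 𝒦, M i)).add
      ((((hFΦ0.const_mul (C' * h)).add (hFζ0.const_mul 2)).const_mul 3).const_mul (4 * (𝒦.card : ℝ)))).add
      ((((hFΦ0.const_mul C').add ((hFζ0.const_mul 2).div_const h)).const_mul
        (3 * (96 * (4 * Λ + 2) ^ N + 2 * h))).const_mul ((2 : ℝ) ^ 𝒦.card))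
    simpa using hlim
  obtain ⟨CJ, hCJdef⟩ : ∃ CJ : ℝ, CJ = 2 ^ 𝒦.card * (3 * (96 * (4 * Λ + 2) ^ N + 2 * h) * (C' * h + 2) * 2) :=
    ⟨_, rfl⟩
  have hCJ : 0 ≤ CJ := by
    have : 0 ≤ 4 * Λ + 2 := by linarith
    rw [hCJdef]; positivity
  -- the threshold
  obtain ⟨T₂, hT₂def⟩ : ∃ T₂ : ℝ, T₂ = max (max T_L T_c) (max (max Tz Tv) TΦ) := ⟨_, rfl⟩
  refine ⟨h, CJ, T₂, ε, hh, hCJ, hεa, hεt, ?_⟩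
  intro T hT n hrootG Dn hDn0 hDn
  have h2L : T_L ≤ T := le_trans (by rw [hT₂def]; simp) hT
  have h2c : T_c ≤ T := le_trans (by rw [hT₂def]; simp) hT
  have h2z : Tz ≤ T := le_trans (by rw [hT₂def]; simp) hT
  have h2v : Tv ≤ T := le_trans (by rw [hT₂def]; simp) hT
  have h2Φ : TΦ ≤ T := le_trans (by rw [hT₂def]; simp) hT
  have hT1 : 1 ≤ T := hL1.trans h2L
  exact frozen_block_virial_integral₀ ξ v M 𝒦 ζ rminF Fζ FΦ Fe hNode hC' hδ hδ1 hΛ hΛκ hc₀ hc₀1 hh hT1 h2L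
    hδ₁a hδ₁b hδ₁c hδ₁d (fun t ht x ↦ hTc t (h2c.trans ht) x) hrle (fun t ht ↦ hTr t ((hLr.trans h2L).trans ht))
    (fun x s s' hs hss' ↦ hTM x s s' ((hLM.trans h2L).trans hs) hss') hrootG
    (fun s t hs hts ↦ hFζdom T h2z s t hs hts) (fun s t hs hts ↦ hFΦdom T h2Φ s t hs hts)
    (fun s t hs hts j ↦ (Finset.single_le_sum (f := fun i ↦ ‖deriv (ξ i) s - v i s‖) (fun i _ ↦ norm_nonneg _)
      (mem_univ j)).trans (hFedom T h2v s t hs hts))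
    hFe1 hFζnn hFζ1 hFΦnn hFΦ1 hFζa hFΦa hFea hM hk1 hvk hvc hξ h𝒦 ε hεdef CJ hCJdef hDn0 hDn

/-- **The virial inequality from the window hypotheses** (see the module docstring): the grid form for a root that is
EVENTUALLY `1`-gapped. [folklore] -/
theorem virial_inequality_of_windows (M : Fin N → ℝ) (ξ v : Fin N → ℝ → E3) (κ : ℝ) (P : ℝ → E3 → ℝ → Fin 4 → ℝ)
    (hM : ∀ i, 0 < M i) (hκ0 : 0 < κ) (hκ1 : κ < 1) (hξ : ∀ i, ContDiff ℝ ((⊤ : ℕ∞) : WithTop ℕ∞) (ξ i))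
    (hcone : ∀ i, ∀ᶠ t in atTop, ‖ξ i t‖ ≤ κ ^ 2 * t)
    (hsep : ∀ i j, i ≠ j → Tendsto (fun t ↦ ‖ξ i t - ξ j t‖) atTop atTop) (hvc : ∀ i, Continuous (v i))
    (hk : ∃ k : ℝ, 0 ≤ k ∧ k < 1 ∧ ∀ i t, ‖v i t‖ ≤ k)
    (hslave : ∀ i, Tendsto (fun t ↦ deriv (ξ i) t - v i t) atTop (𝓝 0))
    (hWL : ∀ ρ : ℝ → ℝ, Tendsto ρ atTop atTop → ∀ δ : ℝ, 0 < δ → δ < 1 → ∃ (C T : ℝ),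
      ∀ (t₁ t₂ : ℝ) (c : ℝ → E3) (R : ℝ → ℝ), T ≤ t₁ → t₁ ≤ t₂ →
      (∀ s ∈ Set.Icc t₁ t₂, ∀ s' ∈ Set.Icc t₁ t₂, ‖c s - c s'‖ ≤ 2 * |s - s'| ∧ |R s - R s'| ≤ 2 * |s - s'|) →
      (∀ s ∈ Set.Icc t₁ t₂, ρ s ≤ δ * R s ∧ ‖c s‖ + R s ≤ (κ + κ ^ 2) / 2 * s ∧
        ∀ j, ‖ξ j s - c s‖ ≤ (1 - δ) * R s ∨ (1 + δ) * R s ≤ ‖ξ j s - c s‖) →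
      ∀ μ : Fin 4, |P t₂ (c t₂) (R t₂) μ - P t₁ (c t₁) (R t₁) μ| ≤ C * ∫ s in t₁..t₂, (R s ^ (3 / 2 : ℝ))⁻¹)
    (hID : ∀ ρ : ℝ → ℝ, Tendsto ρ atTop atTop → ∀ δ : ℝ, 0 < δ → δ < 1 → ∃ (T : ℝ) (ζ : ℝ → ℝ),
      Tendsto ζ atTop (𝓝 0) ∧ ∀ (t : ℝ) (c : E3) (R : ℝ) (A : Finset (Fin N)), T ≤ t → ρ t ≤ δ * R →
      ‖c‖ + R ≤ (κ + κ ^ 2) / 2 * t → (∀ j, ‖ξ j t - c‖ ≤ (1 - δ) * R ∨ (1 + δ) * R ≤ ‖ξ j t - c‖) →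
      (∀ j, j ∈ A ↔ ‖ξ j t - c‖ ≤ (1 - δ) * R) →
      |P t c R 0 - ∑ j ∈ A, M j * (√(1 - ‖v j t‖ ^ 2))⁻¹| ≤ ζ t ∧
      ∀ k : Fin 3, |P t c R k.succ - ∑ j ∈ A, M j * (√(1 - ‖v j t‖ ^ 2))⁻¹ * v j t k| ≤ ζ t)
    (𝒦 : Finset (Fin N)) (h𝒦 : 2 ≤ 𝒦.card)
    (hroot : ∀ᶠ t in atTop, ∃ D G : ℝ, (∀ x ∈ 𝒦, ∀ y ∈ 𝒦, ‖ξ x t - ξ y t‖ ≤ D) ∧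
      (∀ x ∈ 𝒦, ∀ z ∈ univ \ 𝒦, G ≤ ‖ξ x t - ξ z t‖) ∧ 1 * D < G) :
    ∃ (h CJ T₂ : ℝ) (ε : ℝ → ℝ), 0 < h ∧ 0 ≤ CJ ∧ Antitone ε ∧ Tendsto ε atTop (𝓝 0) ∧
      ∀ T : ℝ, T₂ ≤ T → ∀ n : ℕ, ∀ Dn : ℝ, 0 ≤ Dn →
        (∀ x ∈ 𝒦, ∀ y ∈ 𝒦, ‖ξ x (T + n * h) - ξ y (T + n * h)‖ ≤ Dn) →
        (2 * ∑ i ∈ 𝒦, M i)⁻¹ * (∫ s in T..(T + n * h), ∑ j ∈ 𝒦, ∑ l ∈ 𝒦, M j * M l * ‖v j s - v l s‖ ^ 2) -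
            (∫ t in T..(T + n * h), ε t) - CJ * Dn ≤
          (∑ j ∈ 𝒦, inner ℝ ((M j * (√(1 - ‖v j (T + n * h)‖ ^ 2))⁻¹) • v j (T + n * h))
              (ξ j (T + n * h) - (∑ l ∈ 𝒦, M l)⁻¹ • ∑ l ∈ 𝒦, M l • ξ l (T + n * h))) -
          (∑ j ∈ 𝒦, inner ℝ ((M j * (√(1 - ‖v j T‖ ^ 2))⁻¹) • v j T)
              (ξ j T - (∑ l ∈ 𝒦, M l)⁻¹ • ∑ l ∈ 𝒦, M l • ξ l T)) := by
  obtain ⟨h, CJ, T₂, ε, hh, hCJ, hεa, hεt, H⟩ :=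
    virial_inequality_on_grid M ξ v κ P hM hκ0 hκ1 hξ hcone hsep hvc hk hslave hWL hID 𝒦 h𝒦
  obtain ⟨T_R, hTR⟩ := hroot.exists_forall_of_atTop
  refine ⟨h, CJ, max T₂ T_R, ε, hh, hCJ, hεa, hεt, fun T hT n Dn hDn0 hDn ↦ H T ((le_max_left _ _).trans hT) n
    (fun m _ ↦ hTR _ (((le_max_right _ _).trans hT).trans (le_add_of_nonneg_right (by positivity)))) Dn hDn0 hDn⟩

/-- Registered one-line form of `exists_capped_envelope`. [folklore] -/
theorem exists_capped_envelope' : open Filter Topology in ∀ {f : ℝ → ℝ}, Tendsto f atTop (𝓝 0) → ∃ F : ℝ → ℝ, Antitone F ∧ Tendsto F atTop (𝓝 0) ∧ (∀ t, 0 ≤ F t) ∧ (∀ t, F t ≤ 1) ∧ ∃ T₀ : ℝ, 0 ≤ T₀ ∧ ∀ T, T₀ ≤ T → ∀ s t : ℝ, T ≤ s → t / 2 ≤ s → f s ≤ F t :=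
  fun hf ↦ exists_capped_envelope hf

end Summit.FinalStateConjecture.FinalStateConjecture.Theorems.SublinearIsFree.Virial

end
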